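import Literature.Analysis.ODE.TorusFlowFrameInverse
import Literature.Analysis.FluidPDE.LagrangianLatticeCarrier
import Literature.Analysis.FunctionSpaces.TorusCalculusProofs
import HarnessLib

/-!
# Frame regularity of a Lagrangian lattice carrier on a refresh window
# (the `ad-ideate` package FR for `LagrangianLatticeCarrier.flowDeriv`, from `LevelRegular` + `IsFlow`)

Analysis/FluidPDE proof file (theorems only; no definitions, no named facts). Glue between the
generic frame-regularity files `Literature/Analysis/ODE/TorusFlowFrameRegularity.lean`,
`…/TorusFlowFrameInverse.lean` and the Lagrangian carrier structure
`LatticeShear.LagrangianLatticeCarrier` (Armstrong–Vicol §2.2): on the refresh window of level `m+1`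
with left end `w = j · refresh (m+1)` and for window times `s ∈ [0, T]`, `T < refresh (m+1)`,
the qualitative package `LevelRegular` ((L1)–(L3), (F1)) and the flow equation `IsFlow m` deliver
ALL hypotheses of the generic files for
`b r := partialSum m (w + r)`, `D s := disp m (w + s) w` (§2), and the Jacobian entry
`(flowDeriv m (w+s) w y e_c)_a = δ_{ac} + ∂_c D_a(s, y)` (§3, = the cell's `frameJac E m (w+s) w y a c`).
Hence (§4), for every `s ∈ [0,T]`, label `y` and indices:
smooth entries (FR1), all space derivatives jointly continuous (FR2), the variational equation
`∂ₛ(∇X) = ∇b_{≤m}(w+s, X) · ∇X` within `[0,T]` (FR4), Lipschitz in `s` (FR3), `det ∇X = 1`,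
`(∇X)⁻¹ = adj ∇X`, the frame equation `∂ₛ(∇X)⁻¹ = −(∇X)⁻¹ · ∇b_{≤m}(w+s, X)` and the frame-rate bound.
§0–§1: smooth weakly divergence-free fields are divergence free; regularity of the partial sums.

## References

* S. Armstrong, V. Vicol, *Anomalous diffusion by fractal homogenization*, Ann. PDE 11 (2025),
  arXiv:2305.05048, §2.2 (PDF p. 18: the flows `X_m` of `b_{≤m}`, renewed on refresh windows) and
  §5.1 (flow estimates). [`ArmstrongVicol2025`]
* A. J. Majda, A. L. Bertozzi, *Vorticity and Incompressible Flow* (CUP 2002), §1.3, §4.1.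
  [`MajdaBertozziCUP2002`]
-/

noncomputable section

open Set Filter Topology Function MeasureTheory
open scoped NNReal ContDiff InnerProductSpace

/-! ## §0 Smooth weakly divergence-free fields are divergence free -/

namespace Literature.Analysis.FunctionSpaces

namespace Torus

variable {d : Type*} [Fintype d] [DecidableEq d]

/-- **A smooth, weakly divergence-free field on the torus is (pointwise) divergence free**:
test the weak identity with `θ = div u` and integrate by parts (`∫ ⟪u, ∇θ⟫ = −∫ θ div u`), so
`∫ (div u)² = 0`. (Private copy of the lemma of the same name in
`Literature/Barriers/NavierStokesRegularity/SharpLpLinftyNonuniquenessProofs.lean`, whose import cone is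
the Navier–Stokes non-uniqueness chain.) [cite: Evans2010, App. C.2 Thm. 2] -/
private theorem IsWeaklyDivFree.isDivFree_of_isSmooth' {u : UnitAddTorus d → EuclideanSpace ℝ d}
    (hw : IsWeaklyDivFree u) (hu : IsSmooth u) : IsDivFree u := by
  have hθ : IsSmooth (divergence u) := hu.divergence
  have h1 : ∫ x, divergence u x * divergence u x = 0 := by
    have h := hw (divergence u) hθ
    rw [integral_inner_gradient_eq_neg_integral_mul_divergence_holds hu hθ, neg_eq_zero] at h
    exact h
  have hc : Continuous (divergence u) := hθ.continuous
  have hae : (fun x => divergence u x * divergence u x) =ᵐ[volume] 0 :=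
    (integral_eq_zero_iff_of_nonneg (fun x => mul_self_nonneg _)
      ((hc.mul hc).integrable_unitAddTorus)).1 h1
  have heq : (fun x => divergence u x * divergence u x) = 0 :=
    (Continuous.ae_eq_iff_eq volume (hc.mul hc) continuous_zero).1 hae
  intro x
  have hx := congr_fun heq x
  simpa using hx

end Torus

end Literature.Analysis.FunctionSpaces

namespace Literature.Analysis.FluidPDE.LatticeShear

namespace LagrangianLatticeCarrier

open Literature.Analysis.FunctionSpaces Literature.Analysis.FunctionSpaces.Torus
open Literature.Analysis.ODE.TorusFlow

variable {k : ℕ} {E : LagrangianLatticeCarrier k}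

/-! ## §1 Regularity of the partial sums `b_{≤m} = b 1 + ⋯ + b m` -/

/-- (L1, summed) The partial sums are jointly continuous. [cite: ArmstrongVicol2025, §2.2 (PDF p. 18: the b_m are smooth)] -/
theorem LevelRegular.continuous_uncurry_partialSum (h : E.LevelRegular) (m : ℕ) :
    Continuous (Function.uncurry (E.partialSum m)) := by
  have e : Function.uncurry (E.partialSum m) =
      fun p : ℝ × UnitAddTorus (Fin 3) => ∑ i ∈ Finset.range m, Function.uncurry (E.b (i + 1)) p := by
    funext ⟨t, x⟩
    simp [partialSum]
  rw [e]
  exact continuous_finsetSum _ fun i _ => h.continuous_uncurry_b i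

/-- (L3a, summed) The partial sums are smooth in space. [cite: ArmstrongVicol2025, §2.2 (PDF p. 18: the b_m are smooth)] -/
theorem LevelRegular.isSmooth_partialSum (h : E.LevelRegular) (m : ℕ) (t : ℝ) : IsSmooth (E.partialSum m t) := by
  have e : lift (E.partialSum m t) = fun v => ∑ i ∈ Finset.range m, lift (E.b (i + 1) t) v := by
    funext v
    simp [partialSum, lift_apply]
  show ContDiff ℝ ∞ (lift (E.partialSum m t))
  rw [e]
  exact ContDiff.sum fun i _ => (h.isSmooth_b i t : ContDiff ℝ ∞ (lift (E.b (i + 1) t)))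

/-- (L3b, summed) The space derivatives of the partial sums are bounded uniformly in time.
[cite: ArmstrongVicol2025, §2.2 (PDF p. 18: the b_m are smooth)] -/
theorem LevelRegular.exists_norm_iteratedFDeriv_partialSum_le (h : E.LevelRegular) (m n : ℕ) :
    ∃ C : ℝ, ∀ t y, ‖iteratedFDeriv ℝ n (lift (E.partialSum m t)) y‖ ≤ C := by
  choose C hC using fun i => h.exists_norm_iteratedFDeriv_b_le i n
  refine ⟨∑ i ∈ Finset.range m, C i, fun t y => ?_⟩
  have e : lift (E.partialSum m t) = ∑ i ∈ Finset.range m, lift (E.b (i + 1) t) := by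
    funext v
    simp [partialSum, lift_apply, Finset.sum_apply]
  have hcd : ∀ i ∈ Finset.range m, ContDiff ℝ n (lift (E.b (i + 1) t)) := fun i _ => by
    have hi : ContDiff ℝ ∞ (lift (E.b (i + 1) t)) := h.isSmooth_b i t
    exact hi.of_le (by exact_mod_cast le_top)
  rw [e, iteratedFDeriv_sum_apply fun i hi => (hcd i hi).contDiffAt]
  exact (norm_sum_le _ _).trans (Finset.sum_le_sum fun i _ => hC i t y)

/-- (L2 + L3a, summed) The partial sums are divergence free at every time.
[cite: ArmstrongVicol2025, §2.2 (PDF p. 18: divergence-free levels)] -/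
theorem LevelRegular.isDivFree_partialSum (h : E.LevelRegular) (m : ℕ) (t : ℝ) : IsDivFree (E.partialSum m t) := by
  refine IsWeaklyDivFree.isDivFree_of_isSmooth' (fun θ hθ => ?_) (h.isSmooth_partialSum m t)
  have e : ∀ x, ⟪E.partialSum m t x, gradient θ x⟫_ℝ = ∑ i ∈ Finset.range m, ⟪E.b (i + 1) t x, gradient θ x⟫_ℝ := by
    intro x
    rw [partialSum, sum_inner]
  simp_rw [e]
  rw [integral_finsetSum _ fun i _ => ?_]
  · exact Finset.sum_eq_zero fun i _ => h.isWeaklyDivFree_b i t θ hθ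
  · exact ((h.isSmooth_b i t).continuous.inner hθ.gradient.continuous).integrable_unitAddTorus

/-! ## §2 The window data `b r := b_{≤m}(w + r)`, `D s := disp m (w + s) w` satisfy the hypotheses of the generic files -/

/-- Space–time lift continuity from joint continuity on `ℝ × T^d`. [folklore] -/
private theorem continuousOn_stLift_of_continuous {u : ℝ → UnitAddTorus (Fin 3) → EuclideanSpace ℝ (Fin 3)}
    (hu : Continuous fun p : ℝ × UnitAddTorus (Fin 3) => u p.1 p.2) (S : Set (ℝ × EuclideanSpace ℝ (Fin 3))) :
    ContinuousOn (stLift u) S := by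
  have h : Continuous (stLift u) :=
    hu.comp (continuous_fst.prodMk (continuous_proj.comp continuous_snd))
  exact h.continuousOn

/-- (b-side) The shifted partial sum `r ↦ b_{≤m}(w + r)` has continuous space–time lift, smooth slices
and time-uniform derivative bounds. [cite: ArmstrongVicol2025, §2.2 (PDF p. 18)] -/
theorem LevelRegular.window_b_clauses (h : E.LevelRegular) (m : ℕ) (w T : ℝ) :
    ContinuousOn (stLift fun r => E.partialSum m (w + r)) (Icc 0 T ×ˢ univ) ∧
      (∀ t ∈ Icc 0 T, IsSmooth (E.partialSum m (w + t))) ∧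
      (∀ n : ℕ, ∃ C : ℝ, ∀ t ∈ Icc 0 T, ∀ y, ‖iteratedFDeriv ℝ n (lift (E.partialSum m (w + t))) y‖ ≤ C) ∧
      ∀ t ∈ Icc 0 T, IsDivFree (E.partialSum m (w + t)) := by
  refine ⟨?_, fun t _ => h.isSmooth_partialSum m _, fun n => ?_, fun t _ => h.isDivFree_partialSum m _⟩
  · refine continuousOn_stLift_of_continuous ?_ _
    exact (h.continuous_uncurry_partialSum m).comp ((continuous_const.add continuous_fst).prodMk continuous_snd)
  · obtain ⟨C, hC⟩ := h.exists_norm_iteratedFDeriv_partialSum_le m n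
    exact ⟨C, fun t _ y => hC _ y⟩

/-- (D-side) On the refresh window of level `m+1` with left end `w = j · refresh (m+1)`, the displacement
`s ↦ disp m (w + s) w` has continuous space–time lift, smooth slices and, for `T < refresh (m+1)`,
derivative bounds uniform in `s ∈ [0,T]`. [cite: ArmstrongVicol2025, §2.2 (PDF p. 18) and §5.1] -/
theorem LevelRegular.window_disp_clauses (h : E.LevelRegular) (m : ℕ) (j : ℤ) {T : ℝ} (hT : T < E.refresh (m + 1)) :
    ContinuousOn (stLift fun s => E.disp m ((j : ℝ) * E.refresh (m + 1) + s) ((j : ℝ) * E.refresh (m + 1)))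
        (Icc 0 T ×ˢ univ) ∧
      (∀ t ∈ Icc 0 T, IsSmooth (E.disp m ((j : ℝ) * E.refresh (m + 1) + t) ((j : ℝ) * E.refresh (m + 1)))) ∧
      ∀ n : ℕ, ∃ C : ℝ, ∀ t ∈ Icc 0 T, ∀ y,
        ‖iteratedFDeriv ℝ n (lift (E.disp m ((j : ℝ) * E.refresh (m + 1) + t) ((j : ℝ) * E.refresh (m + 1)))) y‖ ≤ C := by
  set w : ℝ := (j : ℝ) * E.refresh (m + 1) with hw
  refine ⟨?_, fun t _ => h.isSmooth_disp m _ _, fun n => ?_⟩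
  · refine continuousOn_stLift_of_continuous ?_ _
    exact (h.continuous_disp m w).comp ((continuous_const.add continuous_fst).prodMk continuous_snd)
  · obtain ⟨C, hC⟩ := h.exists_norm_iteratedFDeriv_disp_le m n j
    refine ⟨C, fun t ht y => hC (w + t) ?_ y⟩
    refine ⟨by rw [hw]; linarith [ht.1], ?_⟩
    rw [hw, add_one_mul]
    linarith [ht.2]

/-- (flow equation on the window) `IsFlow m` in the window variables:
`disp m (w+s) w x = ∫₀ˢ b_{≤m}(w + r, x + proj disp m (w+r) w x) dr`.
[cite: ArmstrongVicol2025, §2.2 (PDF p. 18: the flow ODE (e.flow.m.def))] -/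
theorem IsFlow.window_integral_eq {m : ℕ} (hF : E.IsFlow m) (w s : ℝ) (x : UnitAddTorus (Fin 3)) :
    E.disp m (w + s) w x = ∫ r in (0 : ℝ)..s,
      E.partialSum m (w + r) (x + proj (E.disp m (w + r) w x)) := by
  rw [hF (w + s) w x]
  have h := intervalIntegral.integral_comp_add_left
    (fun r => E.partialSum m r (x + proj (E.disp m r w x))) w (a := 0) (b := s)
  rw [add_zero] at h
  show ∫ r in w..w + s, E.partialSum m r (x + proj (E.disp m r w x)) = _
  exact h.symm

/-! ## §3 The Jacobian entries of `flowDeriv` -/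

/-- **The Jacobian entry read off `flowDeriv`**: `(flowDeriv m t s y e_c)_a = δ_{ac} + ∂_c (disp m t s)_a (y)`
(the cell's `frameJac E m t s y a c`). [cite: ArmstrongVicol2025, §2.2 (PDF p. 18: ∇X_{m−1})] -/
theorem LevelRegular.flowDeriv_single_apply (h : E.LevelRegular) (m : ℕ) (t s : ℝ) (y : UnitAddTorus (Fin 3))
    (c a : Fin 3) :
    (E.flowDeriv m t s y (EuclideanSpace.single c (1 : ℝ))) a =
      (1 : Matrix (Fin 3) (Fin 3) ℝ) a c + partialDeriv c (fun z => E.disp m t s z a) y := by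
  have h1 : IsContDiff 1 (E.disp m t s) := (h.isSmooth_disp m t s).isContDiff (by simp)
  rw [flowDeriv, _root_.add_apply, ContinuousLinearMap.id_apply, PiLp.add_apply,
    fderiv_lift, proj_repr, ← partialDeriv_eq_fderiv_apply h1, partialDeriv_apply_coord h1, Matrix.one_apply,
    show (EuclideanSpace.single c (1 : ℝ) : EuclideanSpace ℝ (Fin 3)) a = if a = c then 1 else 0 from
      PiLp.single_apply 2 ℝ c 1 a]

/-! ## §4 The frame-regularity package on a refresh window -/

section Window

/-- **FR1**: the Jacobian entries `y ↦ (flowDeriv m (w+s) w y e_c)_a` are smooth.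
[cite: ArmstrongVicol2025, §2.2 (PDF p. 18)] -/
theorem LevelRegular.isSmooth_flowDeriv_entry (h : E.LevelRegular) (m : ℕ) (j : ℤ) (s : ℝ) (a c : Fin 3) :
    IsSmooth (fun y => (E.flowDeriv m ((j : ℝ) * E.refresh (m + 1) + s) ((j : ℝ) * E.refresh (m + 1)) y
      (EuclideanSpace.single c (1 : ℝ))) a) := by
  simp_rw [h.flowDeriv_single_apply]
  exact (isSmooth_const _).add (((h.isSmooth_disp m _ _).apply a).partialDeriv c)

/-- **FR2**: all iterated space derivatives of the Jacobian entries are jointly continuous on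
`[0,T] × T³` (space–time lift). [cite: ArmstrongVicol2025, §2.2 (PDF p. 18) and §5.1] -/
theorem LevelRegular.continuousOn_stLift_iterPartialDeriv_flowDeriv_entry (h : E.LevelRegular) (m : ℕ) (j : ℤ)
    {T : ℝ} (hT : T < E.refresh (m + 1)) (a c : Fin 3) (l : List (Fin 3)) :
    ContinuousOn (stLift fun s y => iterPartialDeriv l (fun y =>
      (E.flowDeriv m ((j : ℝ) * E.refresh (m + 1) + s) ((j : ℝ) * E.refresh (m + 1)) y
        (EuclideanSpace.single c (1 : ℝ))) a) y) (Icc 0 T ×ˢ univ) := by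
  obtain ⟨hDc, hDs, hDB⟩ := h.window_disp_clauses m j hT
  simp_rw [h.flowDeriv_single_apply]
  exact continuousOn_stLift_iterPartialDeriv_flowJac_entry hDc hDs hDB a c l

/-- **FR4 — the variational equation on the window, for EVERY window time**:
`∂ₛ (∇X)_{ac}(s, y) = Σⱼ (∂ⱼ b_{≤m,a})(w+s, X(s,y)) · (∇X)_{jc}(s, y)` within `[0,T]`, where
`X(s,·) = X m (w+s) w`. [cite: MajdaBertozziCUP2002, §4.1; ArmstrongVicol2025, §5.1] -/
theorem LevelRegular.hasDerivWithinAt_flowDeriv_entry (h : E.LevelRegular) {m : ℕ} (hF : E.IsFlow m) (j : ℤ)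
    {T : ℝ} (hT : T < E.refresh (m + 1)) {s : ℝ} (hs : s ∈ Icc 0 T) (y : UnitAddTorus (Fin 3))
    (a c : Fin 3) :
    HasDerivWithinAt
      (fun s => (E.flowDeriv m ((j : ℝ) * E.refresh (m + 1) + s) ((j : ℝ) * E.refresh (m + 1)) y
        (EuclideanSpace.single c (1 : ℝ))) a)
      (∑ i, partialDeriv i (fun z => E.partialSum m ((j : ℝ) * E.refresh (m + 1) + s) z a)
          (E.X m ((j : ℝ) * E.refresh (m + 1) + s) ((j : ℝ) * E.refresh (m + 1)) y) *
        (E.flowDeriv m ((j : ℝ) * E.refresh (m + 1) + s) ((j : ℝ) * E.refresh (m + 1)) y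
          (EuclideanSpace.single c (1 : ℝ))) i) (Icc 0 T) s := by
  obtain ⟨hbc, hbs, hbB, -⟩ := h.window_b_clauses m ((j : ℝ) * E.refresh (m + 1)) T
  obtain ⟨hDc, hDs, hDB⟩ := h.window_disp_clauses m j hT
  simp_rw [h.flowDeriv_single_apply]
  exact hasDerivWithinAt_flowJac_entry hbc hbs hbB hDc hDs hDB
    (fun s _ x => hF.window_integral_eq _ s x) hs y a c

/-- **FR3**: the Jacobian entries are Lipschitz in the window time, uniformly in the label.
[cite: MajdaBertozziCUP2002, §4.1; ArmstrongVicol2025, §5.1] -/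
theorem LevelRegular.lipschitzOnWith_flowDeriv_entry (h : E.LevelRegular) {m : ℕ} (hF : E.IsFlow m) (j : ℤ)
    {T : ℝ} (hT : T < E.refresh (m + 1)) :
    ∃ K : ℝ≥0, ∀ (y : UnitAddTorus (Fin 3)) (a c : Fin 3),
      LipschitzOnWith K (fun s => (E.flowDeriv m ((j : ℝ) * E.refresh (m + 1) + s) ((j : ℝ) * E.refresh (m + 1)) y
        (EuclideanSpace.single c (1 : ℝ))) a) (Icc 0 T) := by
  obtain ⟨hbc, hbs, hbB, -⟩ := h.window_b_clauses m ((j : ℝ) * E.refresh (m + 1)) T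
  obtain ⟨hDc, hDs, hDB⟩ := h.window_disp_clauses m j hT
  obtain ⟨K, hK⟩ := lipschitzOnWith_flowJac_entry hbc hbs hbB hDc hDs hDB (fun s _ x => hF.window_integral_eq _ s x)
  refine ⟨K, fun y a c => ?_⟩
  simp_rw [h.flowDeriv_single_apply]
  exact hK y a c

/-- **`det ∇X = 1` on the window** (Liouville for the `t`-continuous, `x`-smooth, divergence-free
partial sums). [cite: MajdaBertozziCUP2002, §1.3 Prop. 1.4; ArmstrongVicol2025, §2.2 (volume-preserving X_m)] -/
theorem LevelRegular.det_flowDeriv_eq_one (h : E.LevelRegular) {m : ℕ} (hF : E.IsFlow m) (j : ℤ)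
    {T : ℝ} (hT : T < E.refresh (m + 1)) {s : ℝ} (hs : s ∈ Icc 0 T) (y : UnitAddTorus (Fin 3)) :
    (Matrix.of fun a c => (E.flowDeriv m ((j : ℝ) * E.refresh (m + 1) + s) ((j : ℝ) * E.refresh (m + 1)) y
      (EuclideanSpace.single c (1 : ℝ))) a).det = 1 := by
  obtain ⟨hbc, hbs, hbB, hdiv⟩ := h.window_b_clauses m ((j : ℝ) * E.refresh (m + 1)) T
  obtain ⟨hDc, hDs, hDB⟩ := h.window_disp_clauses m j hT
  simp_rw [h.flowDeriv_single_apply]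
  exact det_flowJac_eq_one hbc hbs hbB hDc hDs hDB (fun s _ x => hF.window_integral_eq _ s x) hdiv hs y

/-- **`(∇X)⁻¹ = adj ∇X` on the window** (the cell's `frameG` is the adjugate of `frameJac`).
[cite: MajdaBertozziCUP2002, §1.3 Prop. 1.4] -/
theorem LevelRegular.inv_flowDeriv_matrix_eq_adjugate (h : E.LevelRegular) {m : ℕ} (hF : E.IsFlow m) (j : ℤ)
    {T : ℝ} (hT : T < E.refresh (m + 1)) {s : ℝ} (hs : s ∈ Icc 0 T) (y : UnitAddTorus (Fin 3)) :
    (Matrix.of fun a c => (E.flowDeriv m ((j : ℝ) * E.refresh (m + 1) + s) ((j : ℝ) * E.refresh (m + 1)) y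
      (EuclideanSpace.single c (1 : ℝ))) a)⁻¹ =
    (Matrix.of fun a c => (E.flowDeriv m ((j : ℝ) * E.refresh (m + 1) + s) ((j : ℝ) * E.refresh (m + 1)) y
      (EuclideanSpace.single c (1 : ℝ))) a).adjugate := by
  rw [Matrix.inv_def, h.det_flowDeriv_eq_one hF j hT hs y, Ring.inverse_one, one_smul]

/-- **The frame equation on the window**: for `T > 0`, every entry of `G = adj ∇X = (∇X)⁻¹` satisfies
`∂ₛ G_{il}(s,y) = −Σ_q G_{iq}(s,y) · ∂_l b_{≤m,q}(w+s, X(s,y))` within `[0,T]`.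
[cite: MajdaBertozziCUP2002, §4.1] -/
theorem LevelRegular.hasDerivWithinAt_adjugate_flowDeriv_entry (h : E.LevelRegular) {m : ℕ} (hF : E.IsFlow m)
    (j : ℤ) {T : ℝ} (hT : T < E.refresh (m + 1)) (hT0 : 0 < T) {s : ℝ} (hs : s ∈ Icc 0 T)
    (y : UnitAddTorus (Fin 3)) (i l : Fin 3) :
    HasDerivWithinAt
      (fun u => (Matrix.of fun a c => (E.flowDeriv m ((j : ℝ) * E.refresh (m + 1) + u) ((j : ℝ) * E.refresh (m + 1)) y
        (EuclideanSpace.single c (1 : ℝ))) a).adjugate i l)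
      (-(((Matrix.of fun a c => (E.flowDeriv m ((j : ℝ) * E.refresh (m + 1) + s) ((j : ℝ) * E.refresh (m + 1)) y
          (EuclideanSpace.single c (1 : ℝ))) a).adjugate *
        (Matrix.of fun a q => partialDeriv q (fun z => E.partialSum m ((j : ℝ) * E.refresh (m + 1) + s) z a)
          (E.X m ((j : ℝ) * E.refresh (m + 1) + s) ((j : ℝ) * E.refresh (m + 1)) y))) i l)) (Icc 0 T) s := by
  obtain ⟨hbc, hbs, hbB, hdiv⟩ := h.window_b_clauses m ((j : ℝ) * E.refresh (m + 1)) T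
  obtain ⟨hDc, hDs, hDB⟩ := h.window_disp_clauses m j hT
  simp_rw [h.flowDeriv_single_apply]
  exact hasDerivWithinAt_adjugate_flowJac_entry hT0 hbc hbs hbB hDc hDs hDB
    (fun s _ x => hF.window_integral_eq _ s x) hdiv hs y i l

/-- **The frame-rate bound on the window**: with first-order bounds `C_b` for `b_{≤m}` and `C_D` for the
window displacement, `|∂ₛ G_{il}| ≤ 3 · 3! · (1 + C_D)³ · C_b` and the inverse frame is Lipschitz in
the window time uniformly in the label. [cite: MajdaBertozziCUP2002, §4.1; ArmstrongVicol2025, §5.1] -/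
theorem LevelRegular.lipschitzOnWith_adjugate_flowDeriv_entry (h : E.LevelRegular) {m : ℕ} (hF : E.IsFlow m)
    (j : ℤ) {T : ℝ} (hT : T < E.refresh (m + 1)) (hT0 : 0 < T) :
    ∃ K : ℝ≥0, ∀ (y : UnitAddTorus (Fin 3)) (i l : Fin 3),
      LipschitzOnWith K
        (fun u => (Matrix.of fun a c => (E.flowDeriv m ((j : ℝ) * E.refresh (m + 1) + u) ((j : ℝ) * E.refresh (m + 1)) y
          (EuclideanSpace.single c (1 : ℝ))) a).adjugate i l) (Icc 0 T) := by
  obtain ⟨hbc, hbs, hbB, hdiv⟩ := h.window_b_clauses m ((j : ℝ) * E.refresh (m + 1)) T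
  obtain ⟨hDc, hDs, hDB⟩ := h.window_disp_clauses m j hT
  obtain ⟨K, hK⟩ := lipschitzOnWith_adjugate_flowJac_entry hT0 hbc hbs hbB hDc hDs hDB
    (fun s _ x => hF.window_integral_eq _ s x) hdiv
  refine ⟨K, fun y i l => ?_⟩
  simp_rw [h.flowDeriv_single_apply]
  exact hK y i l

end Window

end LagrangianLatticeCarrier

end Literature.Analysis.FluidPDE.LatticeShear

end
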